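import Mathlib
import Summits.Ventures.PercRepro2.Defs
import Summits.Ventures.PercRepro2.Graph
import Summits.Ventures.PercRepro2.HullDefs

/-!
# The same-side lemma in its AVOIDANCE form (blind cell PercRepro2, mine-1 g8; MINE-1.md §23)

For a two-colouring `ζ` (red = `ζ e = true`, blue = the complement), a root `l` and vertex sets
`X`, `Y`, the avoidance event `𝒮(X;Y) = {C_R(l) ∩ X = ∅} ∩ {C_B(l) ∩ Y = ∅}` and the
AVOIDANCE SAME-SIDE SUM

  `A(X;Y) = Σ_ζ 1[𝒮(X;Y)](ζ) · s_{x,l}(ζ) · s_{y,l}(ζ)`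

(`s_{x,l} = 1[x ∈ R_side] − 1[x ∈ B_side]`, `Hull.sideSign`). The statements:

* `AvoidSameSideNonneg`: `A(T;T) ≥ 0` for every `T` — the same-cluster half of the weight-free
  two-copy BHK family (PA_same with `X = Y = T`; the per-hull refinement `Σ_{H_l = H} s_x s_y ≥ 0`
  is FALSE: `C₄` plus two pendant leaves at the antipode of `l`, MINE-1.md §23.2);
* `Nest`: `A(X;Y) ≥ 0` whenever `X ⊆ Y` or `Y ⊆ X` (census 0 / 309,120 at `n = 6`; fails for
  incomparable `X`, `Y`).

Proved here: the colour-swap symmetry `A(X;Y) = A(Y;X)` (the swap `ζ ↦ blue ζ` is a bijection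
of the configurations, exchanges the two clusters and negates both side signs).
-/

namespace Summit.Ventures.PercRepro2

namespace Hull

variable {V : Type*} {E : Type*}

/-- The avoidance event `𝒮(X;Y) = {C_R(l) ∩ X = ∅} ∩ {C_B(l) ∩ Y = ∅}`. -/
def Avoid (ends : E → Sym2 V) (ζ : Config E) (l : V) (X Y : Set V) : Prop :=
  Disjoint (cluster ends ζ l) X ∧ Disjoint (cluster ends (blue ζ) l) Y

/-- The avoidance event of the swapped colouring is the avoidance event with `X`, `Y` exchanged. -/
lemma avoid_blue (ends : E → Sym2 V) (ζ : Config E) (l : V) (X Y : Set V) :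
    Avoid ends (blue ζ) l X Y ↔ Avoid ends ζ l Y X := by
  unfold Avoid
  rw [blue_blue]
  exact and_comm

/-- The side sign of the swapped colouring is the negative of the side sign. -/
lemma sideSign_blue (ends : E → Sym2 V) (ζ : Config E) (l o : V) :
    sideSign ℤ ends (blue ζ) l o = - sideSign ℤ ends ζ l o := by
  unfold sideSign
  rw [rside_blue, bside_blue]
  ring

section Sums

variable [Fintype E] [DecidableEq E]

open scoped Classical in
/-- The avoidance same-side sum `A(X;Y) = Σ_ζ 1[𝒮(X;Y)] s_{x,l} s_{y,l}` (an integer). -/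
noncomputable def avoidSameSide (ends : E → Sym2 V) (l x y : V) (X Y : Set V) : ℤ :=
  ∑ ζ : Config E,
    if Avoid ends ζ l X Y then sideSign ℤ ends ζ l x * sideSign ℤ ends ζ l y else 0

/-- **Colour-swap symmetry**: `A(X;Y) = A(Y;X)`. -/
theorem avoidSameSide_swap (ends : E → Sym2 V) (l x y : V) (X Y : Set V) :
    avoidSameSide ends l x y X Y = avoidSameSide ends l x y Y X := by
  classical
  unfold avoidSameSide
  -- reindex the left-hand sum by the involution `ζ ↦ blue ζ`
  have hinv : Function.Involutive (blue : Config E → Config E) := fun ζ => blue_blue ζ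
  rw [← hinv.bijective.sum_comp (fun ζ => if Avoid ends ζ l X Y then
      sideSign ℤ ends ζ l x * sideSign ℤ ends ζ l y else 0)]
  refine Finset.sum_congr rfl fun ζ _ => ?_
  simp only [avoid_blue, sideSign_blue, neg_mul_neg]

/-- **2′FBHK (same cluster), avoidance form**: `A(T;T) ≥ 0` for every root, pair and set. -/
def AvoidSameSideNonneg (ends : E → Sym2 V) : Prop :=
  ∀ (l x y : V) (T : Set V), 0 ≤ avoidSameSide ends l x y T T

/-- **2′NEST**: `A(X;Y) ≥ 0` whenever `X ⊆ Y` or `Y ⊆ X`. -/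
def Nest (ends : E → Sym2 V) : Prop :=
  ∀ (l x y : V) (X Y : Set V), (X ⊆ Y ∨ Y ⊆ X) → 0 ≤ avoidSameSide ends l x y X Y

/-- `Nest` contains the diagonal statement. -/
theorem avoidSameSideNonneg_of_nest (ends : E → Sym2 V) (h : Nest ends) :
    AvoidSameSideNonneg ends :=
  fun l x y T => h l x y T T (Or.inl subset_rfl)

end Sums

end Hull

end Summit.Ventures.PercRepro2
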